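import Summits.KontsevichZagierPeriods.KontsevichZagierPeriods.Theorems.LinRedNormalFormArrangementNormalFormStubRebaseSimplePosOneFibreCorner

/-!
# Stub `stub_rebaseSimplePosOne` (crux `ArrangementNormalForm`, line `janus-bands`, v6.2) —
part `ResidualSub`: the residual hypotheses with provenance, corners on the closed cell

Two refinements of the assembly `RebasePos.good_above_of_residual` / `good_above_of_corner`
of the one-fibre rebase (one lettered fibre over a base of dimension `B + 1`, letter `0`,
transverse bounds `0 < u < v`), needed to process the cells of the coordinate swap `y ↔ t`
(parts `Swap`, `SwapBand`), where the residual callbacks must remember WHICH band they come from: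
* `RebasePos.good_above_of_residual₂` — the residual hypotheses `Hthick` / `Hfar` are only
  required for SUB-CELLS of the given band: same bounds `u`, `v`, domain contained in the
  given one (this is how `good_above_of_residual` uses them);
* `RebasePos.good_above_of_corner₂` — moreover only for sub-cells whose base cell has a corner
  point (`κ = u = v = 0`, the apex of the band on the letter) in the CLOSURE of the open base
  cell (compactness dichotomy `RebasePos.exists_pos_le_affF_closure` on the closure of the
  normalised open cell; cells without corner are thick, `rebaseSimplePos_thickBand`).
Registered as `rebaseSimplePos_aboveOfCorner2`.

References: M. Kontsevich, D. Zagier, *Periods* (2001), §1.2, rules (1a), (2).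
-/

noncomputable section

open Set MeasureTheory MvPolynomial
open Literature.NumberTheory.Transcendental Literature.ModelTheory.ExponentialFields

namespace Summit.KontsevichZagierPeriods.ArrangementNormalForm.JanusBands

namespace RebasePos

open SeparatePos

section ResidualSub

variable {B m m' : ℕ}

/-- Inequalities between continuous functions pass from the open base cell to its closure. -/
theorem le_of_closure_rows {M : Fin m' → (Fin (B + 1) → ℚ) × ℚ} {f g : (Fin (B + 1 + 1) → ℝ) → ℝ}
    (hf : Continuous f) (hg : Continuous g)
    (h : ∀ z : Fin (B + 1 + 1) → ℝ, (∀ j, 0 < affF B 1 (M j) z) → f z ≤ g z) :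
    ∀ z ∈ closure {z : Fin (B + 1 + 1) → ℝ | ∀ j, 0 < affF B 1 (M j) z}, f z ≤ g z :=
  fun _ hz => closure_minimal (fun z hz => (h z hz : z ∈ {z | f z ≤ g z})) (isClosed_le hf hg) hz

/-- **Extreme value theorem on the closure of the open base cell.** If the base coordinates
are bounded on the open base cell `{rows > 0}` and the affine form `φ` is positive on its
closure, then `φ` is bounded below on the open cell by a positive constant. -/
theorem exists_pos_le_affF_closure (M : Fin m' → (Fin (B + 1) → ℚ) × ℚ) (R : ℝ)
    (hR : ∀ z : Fin (B + 1 + 1) → ℝ, (∀ j, 0 < affF B 1 (M j) z) →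
      ∀ j : Fin (B + 1), |z (Fin.castAdd 1 j)| ≤ R)
    (φ : (Fin (B + 1) → ℚ) × ℚ)
    (hpos : ∀ z ∈ closure {z : Fin (B + 1 + 1) → ℝ | ∀ j, 0 < affF B 1 (M j) z}, 0 < affF B 1 φ z) :
    ∃ c₀ : ℝ, 0 < c₀ ∧ ∀ z : Fin (B + 1 + 1) → ℝ, (∀ j, 0 < affF B 1 (M j) z) → c₀ ≤ affF B 1 φ z := by
  set P : Set (Fin (B + 1 + 1) → ℝ) := {z | ∀ j, 0 < affF B 1 (M j) z} with hP
  set P₀ : Set (Fin (B + 1 + 1) → ℝ) := {z | (∀ j, 0 < affF B 1 (M j) z) ∧ z (tI B) = 0} with hP₀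
  have hsub : P₀ ⊆ P := fun z hz => hz.1
  have hnorm : ∀ z : Fin (B + 1 + 1) → ℝ, (∀ j, 0 < affF B 1 (M j) z) →
      Function.update z (tI B) 0 ∈ P₀ := fun z hz =>
    ⟨fun j => by rw [affF_update_tI]; exact hz j, Function.update_self _ _ _⟩
  have hbdd : Bornology.IsBounded P₀ := isBounded_of_forall_abs_le (max R 0) fun z hz l => by
    obtain ⟨hz, ht⟩ := hz
    refine Fin.addCases (fun j => (hR z hz j).trans (le_max_left _ _)) (fun i => ?_) l
    rw [show Fin.natAdd (B + 1) i = tI B by rw [Subsingleton.elim i 0], ht, abs_zero]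
    exact le_max_right _ _
  have hcpt : IsCompact (closure P₀) :=
    Metric.isCompact_of_isClosed_isBounded isClosed_closure hbdd.closure
  rcases P₀.eq_empty_or_nonempty with hemp | hne
  · refine ⟨1, one_pos, fun z hz => ?_⟩
    have h := hnorm z hz
    rw [hemp] at h
    exact absurd h (notMem_empty _)
  · obtain ⟨z₀, hz₀, hmin⟩ := hcpt.exists_isMinOn hne.closure (continuous_affF φ).continuousOn
    refine ⟨affF B 1 φ z₀, hpos z₀ (closure_mono hsub hz₀), fun z hz => ?_⟩
    have h := isMinOn_iff.1 hmin _ (subset_closure (hnorm z hz))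
    rwa [affF_update_tI] at h

variable (L : Fin m → (Fin B → ℚ) × ℚ) (e : Fin m → ℕ) (ℓ₁ ℓ₂ : (Fin B → ℚ) × ℚ) (n₁ n₂ : ℕ)

/-- **`Hthick` without corner on the closed cell.** As `good_thick_of_noCorner`, with the
corner points sought in the CLOSURE of the open base cell `{rows > 0}`. -/
theorem good_thick_of_noCorner₂ (s : KZ.IntegralRep (B + 1 + 1)) (M : Fin m' → (Fin (B + 1) → ℚ) × ℚ)
    (p : MvPolynomial (Fin B) ℚ) (u v κ : (Fin (B + 1) → ℚ) × ℚ) (A : ℚ)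
    (h12 : n₁ = 0 ∨ n₂ = 0) (hbd : Bornology.IsBounded s.domain)
    (hdom : s.domain = gDom B 1 m' M (fun _ => Sum.inr u) (fun _ => Sum.inr v))
    (hint : EqOn s.integrand (glit B 1 p L e ℓ₁ ℓ₂ n₁ n₂ (fun _ => some 0)) s.domain)
    (hA : u - κ = A • (v - u)) (hA0 : 0 < A)
    (hcell : ∀ z : Fin (B + 1 + 1) → ℝ, (∀ j, 0 < affF B 1 (M j) z) →
      affF B 1 κ z < 0 ∧ 0 < affF B 1 u z ∧ affF B 1 u z < affF B 1 v z)
    (hnc : ∀ z ∈ closure {z : Fin (B + 1 + 1) → ℝ | ∀ j, 0 < affF B 1 (M j) z},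
      affF B 1 κ z = 0 → affF B 1 u z = 0 → affF B 1 v z = 0 → False) :
    ∃ c ∈ AddSubgroup.closure (GGset B 2 1), KZ.of s - c ∈ KZ.relations := by
  have huκ : ∀ z : Fin (B + 1 + 1) → ℝ, affF B 1 u z - affF B 1 κ z =
      (A : ℝ) * (affF B 1 v z - affF B 1 u z) := fun z => by
    have key := congrArg (fun q => affF B 1 q z) hA
    simp only [affF_sub'', affF_smul'] at key
    exact key
  have hA0' : (0 : ℝ) < A := by exact_mod_cast hA0
  obtain ⟨R, -, hR⟩ := exists_base_abs_le M u v (hdom ▸ hbd) fun z hz => (hcell z hz).2.2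
  have hκle := le_of_closure_rows (continuous_affF κ) continuous_const fun z hz => (hcell z hz).1.le
  have hule := le_of_closure_rows continuous_const (continuous_affF u) fun z hz => (hcell z hz).2.1.le
  obtain ⟨c₀, hc₀, hge⟩ := exists_pos_le_affF_closure M R hR (v - u) fun z hz => by
    have hκ0 : affF B 1 κ z ≤ 0 := hκle z hz
    have hu0 : 0 ≤ affF B 1 u z := hule z hz
    rw [affF_sub'']
    by_contra hφ
    push Not at hφ
    have h1 := huκ z
    have hφ0 : affF B 1 v z - affF B 1 u z = 0 := by nlinarith
    rw [hφ0, mul_zero] at h1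
    have hu : affF B 1 u z = 0 := by linarith
    exact hnc z hz (by linarith) hu (by linarith)
  refine good_thickBand L e ℓ₁ ℓ₂ n₁ n₂ s M p u v c₀ h12 hbd hdom hint hc₀ fun z hz => ?_
  have h := hge z hz
  rw [affF_sub''] at h
  exact ⟨(hcell z hz).2.1, by linarith⟩

/-- **`Hfar` without corner on the closed cell.** As `good_far_of_noCorner`, with the corner
points sought in the closure of the open base cell. -/
theorem good_far_of_noCorner₂ (s : KZ.IntegralRep (B + 1 + 1)) (M : Fin m' → (Fin (B + 1) → ℚ) × ℚ)
    (p : MvPolynomial (Fin B) ℚ) (u v κ : (Fin (B + 1) → ℚ) × ℚ) (A : ℚ)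
    (h12 : n₁ = 0 ∨ n₂ = 0) (hbd : Bornology.IsBounded s.domain)
    (hdom : s.domain = gDom B 1 m' M (fun _ => Sum.inr u) (fun _ => Sum.inr v))
    (hint : EqOn s.integrand (glit B 1 p L e ℓ₁ ℓ₂ n₁ n₂ (fun _ => some 0)) s.domain)
    (hA : u - κ = A • (v - u)) (hA0 : 0 < A)
    (hcell : ∀ z : Fin (B + 1 + 1) → ℝ, (∀ j, 0 < affF B 1 (M j) z) →
      0 < affF B 1 κ z ∧ affF B 1 u z < affF B 1 v z ∧ 2 * affF B 1 κ z ≤ affF B 1 v z)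
    (hnc : ∀ z ∈ closure {z : Fin (B + 1 + 1) → ℝ | ∀ j, 0 < affF B 1 (M j) z},
      affF B 1 κ z = 0 → affF B 1 u z = 0 → affF B 1 v z = 0 → False) :
    ∃ c ∈ AddSubgroup.closure (GGset B 2 1), KZ.of s - c ∈ KZ.relations := by
  have huκ : ∀ z : Fin (B + 1 + 1) → ℝ, affF B 1 u z - affF B 1 κ z =
      (A : ℝ) * (affF B 1 v z - affF B 1 u z) := fun z => by
    have key := congrArg (fun q => affF B 1 q z) hA
    simp only [affF_sub'', affF_smul'] at key
    exact key
  have hA0' : (0 : ℝ) < A := by exact_mod_cast hA0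
  obtain ⟨R, -, hR⟩ := exists_base_abs_le M u v (hdom ▸ hbd) fun z hz => (hcell z hz).2.1
  have hκle := le_of_closure_rows continuous_const (continuous_affF κ) fun z hz => (hcell z hz).1.le
  have hfarle := le_of_closure_rows (continuous_const.mul (continuous_affF κ)) (continuous_affF v)
    fun z hz => (hcell z hz).2.2
  obtain ⟨c₀, hc₀, hge⟩ := exists_pos_le_affF_closure M R hR (v - u) fun z hz => by
    have hκ0 : 0 ≤ affF B 1 κ z := hκle z hz
    have hfar : 2 * affF B 1 κ z ≤ affF B 1 v z := hfarle z hz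
    rw [affF_sub'']
    by_contra hφ
    push Not at hφ
    have h1 := huκ z
    have hφ0 : affF B 1 v z - affF B 1 u z = 0 := by nlinarith
    have hκ : affF B 1 κ z = 0 := by nlinarith
    exact hnc z hz hκ (by nlinarith) (by nlinarith)
  refine good_thickBand L e ℓ₁ ℓ₂ n₁ n₂ s M p u v c₀ h12 hbd hdom hint hc₀ fun z hz => ?_
  obtain ⟨hκ, huv, hfar⟩ := hcell z hz
  have h := hge z hz
  rw [affF_sub''] at h
  refine ⟨?_, by linarith⟩
  nlinarith [huκ z]

/-- **A band above its letter, residual hypotheses with provenance.** As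
`good_above_of_residual`, but `Hthick` and `Hfar` are only required for bands with the SAME
bounds `u < v` whose domain is contained in the given one (sub-cells of its base cell). -/
theorem good_above_of_residual₂ (s : KZ.IntegralRep (B + 1 + 1)) (M : Fin m' → (Fin (B + 1) → ℚ) × ℚ)
    (p : MvPolynomial (Fin B) ℚ) (u v : (Fin (B + 1) → ℚ) × ℚ) (h12 : n₁ = 0 ∨ n₂ = 0)
    (hbd : Bornology.IsBounded s.domain)
    (hdom : s.domain = gDom B 1 m' M (fun _ => Sum.inr u) (fun _ => Sum.inr v))
    (hint : EqOn s.integrand (glit B 1 p L e ℓ₁ ℓ₂ n₁ n₂ (fun _ => some 0)) s.domain)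
    (hu : u.1 (Fin.last B) ≠ 0) (hv : v.1 (Fin.last B) ≠ 0)
    (hcell : ∀ z : Fin (B + 1 + 1) → ℝ, (∀ j, 0 < affF B 1 (M j) z) →
      0 < affF B 1 u z ∧ affF B 1 u z < affF B 1 v z)
    (Hpar : ∀ (m' : ℕ) (s : KZ.IntegralRep (B + 1 + 1)) (M : Fin m' → (Fin (B + 1) → ℚ) × ℚ)
      (p : MvPolynomial (Fin B) ℚ) (u v : (Fin (B + 1) → ℚ) × ℚ), Bornology.IsBounded s.domain →
      s.domain = gDom B 1 m' M (fun _ => Sum.inr u) (fun _ => Sum.inr v) →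
      EqOn s.integrand (glit B 1 p L e ℓ₁ ℓ₂ n₁ n₂ (fun _ => some 0)) s.domain →
      u.1 (Fin.last B) ≠ 0 → u.1 (Fin.last B) = v.1 (Fin.last B) →
      (∀ z : Fin (B + 1 + 1) → ℝ, (∀ j, 0 < affF B 1 (M j) z) → 0 < affF B 1 u z ∧ affF B 1 u z < affF B 1 v z) →
      ∃ c ∈ AddSubgroup.closure (GGset B 2 1), KZ.of s - c ∈ KZ.relations)
    (Hthick : ∀ (m'' : ℕ) (s' : KZ.IntegralRep (B + 1 + 1)) (M' : Fin m'' → (Fin (B + 1) → ℚ) × ℚ)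
      (κ : (Fin (B + 1) → ℚ) × ℚ) (A : ℚ), s'.domain ⊆ s.domain → Bornology.IsBounded s'.domain →
      s'.domain = gDom B 1 m'' M' (fun _ => Sum.inr u) (fun _ => Sum.inr v) →
      EqOn s'.integrand (glit B 1 p L e ℓ₁ ℓ₂ n₁ n₂ (fun _ => some 0)) s'.domain →
      κ.1 (Fin.last B) = 0 → u - κ = A • (v - u) → 0 < A →
      (∀ z : Fin (B + 1 + 1) → ℝ, (∀ j, 0 < affF B 1 (M' j) z) →
        affF B 1 κ z < 0 ∧ 0 < affF B 1 u z ∧ affF B 1 u z < affF B 1 v z) →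
      ∃ c ∈ AddSubgroup.closure (GGset B 2 1), KZ.of s' - c ∈ KZ.relations)
    (Hfar : ∀ (m'' : ℕ) (s' : KZ.IntegralRep (B + 1 + 1)) (M' : Fin m'' → (Fin (B + 1) → ℚ) × ℚ)
      (κ : (Fin (B + 1) → ℚ) × ℚ) (A : ℚ), s'.domain ⊆ s.domain → Bornology.IsBounded s'.domain →
      s'.domain = gDom B 1 m'' M' (fun _ => Sum.inr u) (fun _ => Sum.inr v) →
      EqOn s'.integrand (glit B 1 p L e ℓ₁ ℓ₂ n₁ n₂ (fun _ => some 0)) s'.domain →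
      κ.1 (Fin.last B) = 0 → u - κ = A • (v - u) → 0 < A →
      (∀ z : Fin (B + 1 + 1) → ℝ, (∀ j, 0 < affF B 1 (M' j) z) →
        0 < affF B 1 κ z ∧ affF B 1 u z < affF B 1 v z ∧ 2 * affF B 1 κ z ≤ affF B 1 v z) →
      ∃ c ∈ AddSubgroup.closure (GGset B 2 1), KZ.of s' - c ∈ KZ.relations) :
    ∃ c ∈ AddSubgroup.closure (GGset B 2 1), KZ.of s - c ∈ KZ.relations := by
  by_cases hpar : u.1 (Fin.last B) = v.1 (Fin.last B)
  · exact Hpar m' s M p u v hbd hdom hint hu hpar hcell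
  -- the apex level
  set A' : ℚ := u.1 (Fin.last B) with hA'
  set B' : ℚ := v.1 (Fin.last B) with hB'
  have hBA : B' - A' ≠ 0 := sub_ne_zero.2 (Ne.symm hpar)
  set A : ℚ := A' / (B' - A') with hAdef
  set κ : (Fin (B + 1) → ℚ) × ℚ := u - A • (v - u) with hκdef
  have hκ : κ.1 (Fin.last B) = 0 := by
    simp only [hκdef, Prod.fst_sub, Prod.smul_fst, Pi.sub_apply, Pi.smul_apply, smul_eq_mul, hAdef]
    rw [← hA', ← hB']
    field_simp
    ring
  have hA : u - κ = A • (v - u) := by rw [hκdef, sub_sub_cancel]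
  have hA1 : A ≠ -1 := fun h => by
    have : A' = -(B' - A') := by
      rw [hAdef] at h
      field_simp at h
      linarith
    exact hv (show B' = 0 by linarith)
  have hA0 : A ≠ 0 := fun h => by
    rw [hAdef, div_eq_zero_iff] at h
    exact h.elim hu hBA
  have huκ : ∀ z : Fin (B + 1 + 1) → ℝ, affF B 1 u z - affF B 1 κ z =
      (A : ℝ) * (affF B 1 v z - affF B 1 u z) := fun z => by
    have key := congrArg (fun q => affF B 1 q z) hA
    simp only [affF_sub'', affF_smul'] at key
    exact key
  rcases lt_trichotomy A (-1) with hlt | heq | hgt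
  · -- below the apex
    exact good_belowApex L e ℓ₁ ℓ₂ n₁ n₂ s M p u v κ A h12 hbd hdom hint hκ hA (by linarith) hcell
  · exact absurd heq hA1
  rcases lt_trichotomy A 0 with hlt0 | heq0 | hgt0
  · -- the apex level separates the bounds
    have hlt' : (A : ℝ) < 0 := by exact_mod_cast hlt0
    have hgt' : (-1 : ℝ) < A := by exact_mod_cast hgt
    refine good_levelSplit (fun _ => some 0) (fun _ => u) (fun _ => v) s M L e p ℓ₁ ℓ₂
      (fun _ => Sum.inr u) (fun _ => Sum.inr v) h12 hbd hdom hint (fun _ => rfl) (fun _ => rfl) 0 κ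
      (fun i c hi _ => absurd (Subsingleton.elim i 0) hi) (fun c hc => by cases hc; simpa using hκ)
      fun z hz => ?_
    have h1 := huκ z
    have h2 := (hcell z hz).2
    constructor <;> nlinarith
  · exact absurd heq0 hA0
  -- above the apex (`A > 0`)
  by_cases hκ0 : κ = 0
  · -- apex on the letter: coaxial blow-up
    exact good_coaxial 0 s M L e p ℓ₁ ℓ₂ n₁ n₂ u v A h12 hbd hdom hint (by rw [sub_zero, ← hA, hκ0, sub_zero])
      fun z hz => (hcell z hz).2
  -- cut by the sign of `κ`
  obtain ⟨s₁, s₂, hm₁, hm₂, hi₁, hi₂, hd₁, hd₂, hrel⟩ := cutBase s M _ _ hdom κ hκ0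
  have hsub₁ : s₁.domain ⊆ s.domain := fun z hz => ((hm₁ z).1 hz).1
  have hsub₂ : s₂.domain ⊆ s.domain := fun z hz => ((hm₂ z).1 hz).1
  refine good_of_split hrel ?_ ?_
  · -- `κ > 0`: cut by the sign of `v - 2κ`
    have hne : v - (2 : ℚ) • κ ≠ 0 := ne_zero_of_last (by
      simp only [Prod.fst_sub, Prod.smul_fst, Pi.sub_apply, Pi.smul_apply, smul_eq_mul, hκ,
        mul_zero, sub_zero]
      exact hv)
    obtain ⟨s₃, s₄, hm₃, hm₄, hi₃, hi₄, hd₃, hd₄, hrel'⟩ := cutBase s₁ (Fin.snoc M κ) _ _ hd₁ _ hne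
    have hsub₃ : s₃.domain ⊆ s.domain := fun z hz => hsub₁ ((hm₃ z).1 hz).1
    have hsub₄ : s₄.domain ⊆ s.domain := fun z hz => hsub₁ ((hm₄ z).1 hz).1
    have h2κ : ∀ z : Fin (B + 1 + 1) → ℝ, affF B 1 (v - (2 : ℚ) • κ) z = affF B 1 v z - 2 * affF B 1 κ z :=
      fun z => by rw [affF_sub'', affF_smul']; push_cast; ring
    refine good_of_split hrel' ?_ ?_
    · -- far regime: residual hypothesis
      refine Hfar _ s₃ _ κ A hsub₃ (hbd.subset hsub₃) hd₃ (by rw [hi₃, hi₁]; exact hint.mono hsub₃)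
        hκ hA hgt0 fun z hz => ?_
      obtain ⟨hz', hfar⟩ := rows_snoc hz
      obtain ⟨hz'', hκpos⟩ := rows_snoc hz'
      rw [h2κ] at hfar
      exact ⟨hκpos, (hcell z hz'').2, by linarith⟩
    · -- near regime
      refine good_aboveApexNear L e ℓ₁ ℓ₂ n₁ n₂ s₄ _ p u v κ A 2 h12 (hbd.subset hsub₄) hd₄
        (by rw [hi₄, hi₁]; exact hint.mono hsub₄) hκ hA hgt0.le fun z hz => ?_
      obtain ⟨hz', hnear⟩ := rows_snoc hz
      obtain ⟨hz'', hκpos⟩ := rows_snoc hz'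
      rw [affF_neg', h2κ] at hnear
      exact ⟨hκpos, (hcell z hz'').2, by linarith⟩
  · -- `κ < 0`: residual hypothesis
    refine Hthick _ s₂ _ κ A hsub₂ (hbd.subset hsub₂) hd₂ (by rw [hi₂]; exact hint.mono hsub₂)
      hκ hA hgt0 fun z hz => ?_
    obtain ⟨hz', hneg⟩ := rows_snoc hz
    rw [affF_neg'] at hneg
    exact ⟨by linarith, hcell z hz'⟩

/-- **A band above its letter, from parallel bands and CORNER SUB-CELLS.** As
`good_above_of_residual₂`, and moreover `Hthick` / `Hfar` are only required for sub-cells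
whose base cell has a corner point (`κ = u = v = 0`) in the closure of its open base cell
(cells without corner are thick: `good_thick_of_noCorner₂`, `good_far_of_noCorner₂`). -/
theorem good_above_of_corner₂ (s : KZ.IntegralRep (B + 1 + 1)) (M : Fin m' → (Fin (B + 1) → ℚ) × ℚ)
    (p : MvPolynomial (Fin B) ℚ) (u v : (Fin (B + 1) → ℚ) × ℚ) (h12 : n₁ = 0 ∨ n₂ = 0)
    (hbd : Bornology.IsBounded s.domain)
    (hdom : s.domain = gDom B 1 m' M (fun _ => Sum.inr u) (fun _ => Sum.inr v))
    (hint : EqOn s.integrand (glit B 1 p L e ℓ₁ ℓ₂ n₁ n₂ (fun _ => some 0)) s.domain)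
    (hu : u.1 (Fin.last B) ≠ 0) (hv : v.1 (Fin.last B) ≠ 0)
    (hcell : ∀ z : Fin (B + 1 + 1) → ℝ, (∀ j, 0 < affF B 1 (M j) z) →
      0 < affF B 1 u z ∧ affF B 1 u z < affF B 1 v z)
    (Hpar : ∀ (m' : ℕ) (s : KZ.IntegralRep (B + 1 + 1)) (M : Fin m' → (Fin (B + 1) → ℚ) × ℚ)
      (p : MvPolynomial (Fin B) ℚ) (u v : (Fin (B + 1) → ℚ) × ℚ), Bornology.IsBounded s.domain →
      s.domain = gDom B 1 m' M (fun _ => Sum.inr u) (fun _ => Sum.inr v) →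
      EqOn s.integrand (glit B 1 p L e ℓ₁ ℓ₂ n₁ n₂ (fun _ => some 0)) s.domain →
      u.1 (Fin.last B) ≠ 0 → u.1 (Fin.last B) = v.1 (Fin.last B) →
      (∀ z : Fin (B + 1 + 1) → ℝ, (∀ j, 0 < affF B 1 (M j) z) → 0 < affF B 1 u z ∧ affF B 1 u z < affF B 1 v z) →
      ∃ c ∈ AddSubgroup.closure (GGset B 2 1), KZ.of s - c ∈ KZ.relations)
    (Hthick : ∀ (m'' : ℕ) (s' : KZ.IntegralRep (B + 1 + 1)) (M' : Fin m'' → (Fin (B + 1) → ℚ) × ℚ)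
      (κ : (Fin (B + 1) → ℚ) × ℚ) (A : ℚ), s'.domain ⊆ s.domain → Bornology.IsBounded s'.domain →
      s'.domain = gDom B 1 m'' M' (fun _ => Sum.inr u) (fun _ => Sum.inr v) →
      EqOn s'.integrand (glit B 1 p L e ℓ₁ ℓ₂ n₁ n₂ (fun _ => some 0)) s'.domain →
      κ.1 (Fin.last B) = 0 → u - κ = A • (v - u) → 0 < A →
      (∀ z : Fin (B + 1 + 1) → ℝ, (∀ j, 0 < affF B 1 (M' j) z) →
        affF B 1 κ z < 0 ∧ 0 < affF B 1 u z ∧ affF B 1 u z < affF B 1 v z) →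
      (∃ z ∈ closure {z : Fin (B + 1 + 1) → ℝ | ∀ j, 0 < affF B 1 (M' j) z},
        affF B 1 κ z = 0 ∧ affF B 1 u z = 0 ∧ affF B 1 v z = 0) →
      ∃ c ∈ AddSubgroup.closure (GGset B 2 1), KZ.of s' - c ∈ KZ.relations)
    (Hfar : ∀ (m'' : ℕ) (s' : KZ.IntegralRep (B + 1 + 1)) (M' : Fin m'' → (Fin (B + 1) → ℚ) × ℚ)
      (κ : (Fin (B + 1) → ℚ) × ℚ) (A : ℚ), s'.domain ⊆ s.domain → Bornology.IsBounded s'.domain →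
      s'.domain = gDom B 1 m'' M' (fun _ => Sum.inr u) (fun _ => Sum.inr v) →
      EqOn s'.integrand (glit B 1 p L e ℓ₁ ℓ₂ n₁ n₂ (fun _ => some 0)) s'.domain →
      κ.1 (Fin.last B) = 0 → u - κ = A • (v - u) → 0 < A →
      (∀ z : Fin (B + 1 + 1) → ℝ, (∀ j, 0 < affF B 1 (M' j) z) →
        0 < affF B 1 κ z ∧ affF B 1 u z < affF B 1 v z ∧ 2 * affF B 1 κ z ≤ affF B 1 v z) →
      (∃ z ∈ closure {z : Fin (B + 1 + 1) → ℝ | ∀ j, 0 < affF B 1 (M' j) z},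
        affF B 1 κ z = 0 ∧ affF B 1 u z = 0 ∧ affF B 1 v z = 0) →
      ∃ c ∈ AddSubgroup.closure (GGset B 2 1), KZ.of s' - c ∈ KZ.relations) :
    ∃ c ∈ AddSubgroup.closure (GGset B 2 1), KZ.of s - c ∈ KZ.relations := by
  refine good_above_of_residual₂ L e ℓ₁ ℓ₂ n₁ n₂ s M p u v h12 hbd hdom hint hu hv hcell Hpar
    (fun m'' s' M' κ A hsub hbd' hdom' hint' hκ hA hA0 hcell' => ?_)
    (fun m'' s' M' κ A hsub hbd' hdom' hint' hκ hA hA0 hcell' => ?_)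
  · by_cases hc : ∃ z ∈ closure {z : Fin (B + 1 + 1) → ℝ | ∀ j, 0 < affF B 1 (M' j) z},
        affF B 1 κ z = 0 ∧ affF B 1 u z = 0 ∧ affF B 1 v z = 0
    · exact Hthick m'' s' M' κ A hsub hbd' hdom' hint' hκ hA hA0 hcell' hc
    · push Not at hc
      exact good_thick_of_noCorner₂ L e ℓ₁ ℓ₂ n₁ n₂ s' M' p u v κ A h12 hbd' hdom' hint' hA hA0 hcell'
        fun z hz h1 h2 h3 => hc z hz h1 h2 h3
  · by_cases hc : ∃ z ∈ closure {z : Fin (B + 1 + 1) → ℝ | ∀ j, 0 < affF B 1 (M' j) z},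
        affF B 1 κ z = 0 ∧ affF B 1 u z = 0 ∧ affF B 1 v z = 0
    · exact Hfar m'' s' M' κ A hsub hbd' hdom' hint' hκ hA hA0 hcell' hc
    · push Not at hc
      exact good_far_of_noCorner₂ L e ℓ₁ ℓ₂ n₁ n₂ s' M' p u v κ A h12 hbd' hdom' hint' hA hA0 hcell'
        fun z hz h1 h2 h3 => hc z hz h1 h2 h3

end ResidualSub

end RebasePos

/-- **Registered part of `stub_rebaseSimplePosOne` (line `janus-bands`, v6.2): a band above
its letter from parallel bands and corner sub-cells.** One lettered fibre over a base of
dimension `B + 1` (letter `0`, transverse affine bounds `0 < u < v` on the base cell, exponents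
`n₁ n₂` with `n₁ = 0 ∨ n₂ = 0`): IF parallel bands are good (`Hpar`) and the SUB-CELLS of the
given band (same bounds, smaller domain) lying above their apex level `κ` (`u − κ = A (v − u)`,
`A > 0`) with `κ < 0` (`Hthick`) or `0 < κ`, `v ≥ 2κ` (`Hfar`) AND with a corner point
`κ = u = v = 0` in the closure of their open base cell are good, THEN `[s]` is congruent modulo
`KZ.relations` to the subgroup generated by `GG B 2 1` (`RebasePos.good_above_of_corner₂`). -/
theorem rebaseSimplePos_aboveOfCorner2 (B m m' n₁ n₂ : ℕ) (s : KZ.IntegralRep (B + 1 + 1)) (M : Fin m' → (Fin (B + 1) → ℚ) × ℚ) (L : Fin m → (Fin B → ℚ) × ℚ) (e : Fin m → ℕ) (p : MvPolynomial (Fin B) ℚ) (ℓ₁ ℓ₂ : (Fin B → ℚ) × ℚ) (u v : (Fin (B + 1) → ℚ) × ℚ) (h12 : n₁ = 0 ∨ n₂ = 0) (hbd : Bornology.IsBounded s.domain) (hdom : s.domain = SeparatePos.gDom B 1 m' M (fun _ => Sum.inr u) (fun _ => Sum.inr v)) (hint : EqOn s.integrand (RebasePos.glit B 1 p L e ℓ₁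 ℓ₂ n₁ n₂ (fun _ => some 0)) s.domain) (hu : u.1 (Fin.last B) ≠ 0) (hv : v.1 (Fin.last B) ≠ 0) (hcell : ∀ z : Fin (B + 1 + 1) → ℝ, (∀ j, 0 < SeparatePos.affF B 1 (M j) z) → 0 < SeparatePos.affF B 1 u z ∧ SeparatePos.affF B 1 u z < SeparatePos.affF B 1 v z) (Hpar : ∀ (m' : ℕ) (s : KZ.IntegralRep (B + 1 + 1)) (M : Fin m' → (Fin (B + 1) → ℚ) × ℚ) (p : MvPolynomial (Fin B) ℚ) (u v : (Fin (B + 1) → ℚ) × ℚ), Bornology.IsBounded s.domain → s.domain = SeparatePos.gDom B 1 m' M (fun _ => Sum.inr u) (fun _ => Sum.inr v) → EqOn s.integrand (RebasePos.glit B 1 p L e ℓ₁ ℓ₂ n₁ n₂ (fun _ => some 0)) s.domain → u.1 (Fin.last B) ≠ 0 → u.1 (Fin.last B) = v.1 (Fin.last B) → (∀ z : Fin (B + 1 + 1) → ℝ, (∀ j, 0 < SeparatePos.affF B 1 (M j) z) → 0 < SeparatePos.affF B 1 u z ∧ SeparatePos.affF B 1 u z < SeparatePos.affF B 1 v z) →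 ∃ c ∈ AddSubgroup.closure (SeparatePos.GGset B 2 1), KZ.of s - c ∈ KZ.relations) (Hthick : ∀ (m'' : ℕ) (s' : KZ.IntegralRep (B + 1 + 1)) (M' : Fin m'' → (Fin (B + 1) → ℚ) × ℚ) (κ : (Fin (B + 1) → ℚ) × ℚ) (A : ℚ), s'.domain ⊆ s.domain → Bornology.IsBounded s'.domain → s'.domain = SeparatePos.gDom B 1 m'' M' (fun _ => Sum.inr u) (fun _ => Sum.inr v) → EqOn s'.integrand (RebasePos.glit B 1 p L e ℓ₁ ℓ₂ n₁ n₂ (fun _ => some 0)) s'.domain → κ.1 (Fin.last B) = 0 → u - κ = A • (v - u) → 0 < A → (∀ z : Fin (B + 1 + 1) → ℝ, (∀ j, 0 < SeparatePos.affF B 1 (M' j) z) → SeparatePos.affF B 1 κ z < 0 ∧ 0 < SeparatePos.affF B 1 u z ∧ SeparatePos.affF B 1 u z < SeparatePos.affF B 1 v z) → (∃ z ∈ closure {z : Fin (B + 1 + 1) → ℝ | ∀ j, 0 < SeparatePos.affF B 1 (M' j) z}, SeparatePos.affF B 1 κ z = 0 ∧ SeparatePos.affF B 1 u z = 0 ∧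 SeparatePos.affF B 1 v z = 0) → ∃ c ∈ AddSubgroup.closure (SeparatePos.GGset B 2 1), KZ.of s' - c ∈ KZ.relations) (Hfar : ∀ (m'' : ℕ) (s' : KZ.IntegralRep (B + 1 + 1)) (M' : Fin m'' → (Fin (B + 1) → ℚ) × ℚ) (κ : (Fin (B + 1) → ℚ) × ℚ) (A : ℚ), s'.domain ⊆ s.domain → Bornology.IsBounded s'.domain → s'.domain = SeparatePos.gDom B 1 m'' M' (fun _ => Sum.inr u) (fun _ => Sum.inr v) → EqOn s'.integrand (RebasePos.glit B 1 p L e ℓ₁ ℓ₂ n₁ n₂ (fun _ => some 0)) s'.domain → κ.1 (Fin.last B) = 0 → u - κ = A • (v - u) → 0 < A → (∀ z : Fin (B + 1 + 1) → ℝ, (∀ j, 0 < SeparatePos.affF B 1 (M' j) z) → 0 < SeparatePos.affF B 1 κ z ∧ SeparatePos.affF B 1 u z < SeparatePos.affF B 1 v z ∧ 2 * SeparatePos.affF B 1 κ z ≤ SeparatePos.affF B 1 v z) → (∃ z ∈ closure {z : Fin (B + 1 + 1) → ℝ | ∀ j, 0 < SeparatePos.affF B 1 (M' j) z}, SeparatePos.affF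 B 1 κ z = 0 ∧ SeparatePos.affF B 1 u z = 0 ∧ SeparatePos.affF B 1 v z = 0) → ∃ c ∈ AddSubgroup.closure (SeparatePos.GGset B 2 1), KZ.of s' - c ∈ KZ.relations) : ∃ c ∈ AddSubgroup.closure (SeparatePos.GGset B 2 1), KZ.of s - c ∈ KZ.relations :=
  RebasePos.good_above_of_corner₂ L e ℓ₁ ℓ₂ n₁ n₂ s M p u v h12 hbd hdom hint hu hv hcell Hpar Hthick Hfar

end Summit.KontsevichZagierPeriods.ArrangementNormalForm.JanusBands
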